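import Summits.HodgeConjecture.HodgeCM.Automorphic.WeilThetaModelDerivCalculus_1

/-! PORT of `HodgeCM/Automorphic/WeilThetaModelDerivCalculus.lean` (HodgeCMPerL run 82) — part 2: continuation of `Summits.HodgeConjecture.HodgeCM.Automorphic.WeilThetaModelDerivCalculus_1` (split at a top-level declaration boundary by port_pkg.py; scope re-opened below; declarations unchanged). -/

-- port_pkg: scope re-opened for this part (file-level context, then the namespace/section stack open at the cut)
noncomputable section
open Filter Topology
open scoped SchwartzMap
namespace HodgeCM
namespace WeilThetaModel
variable {GU : Type} [Group GU] [TopologicalSpace GU] {ΓU : Subgroup GU}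
variable {G : Type} [Group G] [TopologicalSpace G] {Γ : Subgroup G}
variable {M : WeilThetaModel GU ΓU G Γ} [M.LinearStr]
section FiniteDimensional
variable [ContinuousAdd M.W.SX] [ContinuousSMul ℂ M.W.SX]
/-- **Detection through an injective observation.**  `V ⊆ 𝒮^κ` a finite-dimensional subspace containing the curve
`γ` and the candidate derivative `γ'`; `A : 𝒮^κ →ₗ[ℂ] E` a linear map to a Hausdorff topological vector space,
injective on `V` (NO continuity asked of `A`).  If the difference quotients of `A ∘ γ` converge to `A γ'` in `E`,
then `γ` has `SK`-derivative `γ'` in Weil's topology. -/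
theorem hasSKDerivAt_of_injOn {E : Type*} [AddCommGroup E] [Module ℂ E] [TopologicalSpace E]
    [IsTopologicalAddGroup E] [ContinuousSMul ℂ E] [T2Space E]
    (A : M.SK →ₗ[ℂ] E) (V : Submodule ℂ M.SK) [FiniteDimensional ℂ V] (hA : ∀ v ∈ V, A v = 0 → v = 0)
    {γ : ℝ → M.SK} {γ' : M.SK} {s₀ : ℝ} (hγ : ∀ s, γ s ∈ V) (hγ' : γ' ∈ V)
    (h : Tendsto (slope (fun s => A (γ s)) s₀) (𝓝[≠] s₀) (𝓝 (A γ'))) : M.HasSKDerivAt γ γ' s₀ := by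
  set B : V →ₗ[ℂ] E := A ∘ₗ V.subtype with hB_def
  have hB : Function.Injective B := by
    intro v w hvw
    have h0 : A (v - w : V) = 0 := by
      have : B v - B w = 0 := sub_eq_zero.mpr hvw
      simpa [hB_def, map_sub] using this
    have := hA _ (v - w).2 h0
    exact sub_eq_zero.mp (by exact_mod_cast this)
  set e : V ≃ₗ[ℂ] (LinearMap.range B) := LinearEquiv.ofInjective B hB
  haveI : FiniteDimensional ℂ (LinearMap.range B) := LinearEquiv.finiteDimensional e
  let ι : LinearMap.range B →ₗ[ℂ] M.SK := V.subtype ∘ₗ e.symm.toLinearMap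
  let d : ℝ → LinearMap.range B := fun s => ⟨A (γ s), ⟨⟨γ s, hγ s⟩, rfl⟩⟩
  let d' : LinearMap.range B := ⟨A γ', ⟨⟨γ', hγ'⟩, rfl⟩⟩
  have hd : Tendsto (slope d s₀) (𝓝[≠] s₀) (𝓝 d') := (tendsto_slope_submodule_iff _).2 h
  have main := hasSKDerivAt_of_finiteDimensional (M := M) ι hd
  have he : ∀ (v : V), e.symm ⟨A v, ⟨v, rfl⟩⟩ = v := fun v => by
    have h1 : e v = ⟨A v, ⟨v, rfl⟩⟩ := Subtype.ext (LinearEquiv.ofInjective_apply B v)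
    rw [← h1, LinearEquiv.symm_apply_apply]
  have hι : ∀ s, ι (d s) = γ s := fun s => by
    show V.subtype (e.symm ⟨A (γ s), _⟩) = γ s
    rw [he ⟨γ s, hγ s⟩]; rfl
  have hι' : ι d' = γ' := by
    show V.subtype (e.symm ⟨A γ', _⟩) = γ'
    rw [he ⟨γ', hγ'⟩]; rfl
  exact (main.congr fun s => (hι s).symm).congr_deriv hι'.symm

/-- The same with a normed target and `HasDerivAt` (e.g. `E = L²`, where pv05's Fock-model derivatives live). -/
theorem hasSKDerivAt_of_injOn_of_hasDerivAt {E : Type*} [NormedAddCommGroup E] [NormedSpace ℂ E]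
    (A : M.SK →ₗ[ℂ] E) (V : Submodule ℂ M.SK) [FiniteDimensional ℂ V] (hA : ∀ v ∈ V, A v = 0 → v = 0)
    {γ : ℝ → M.SK} {γ' : M.SK} {s₀ : ℝ} (hγ : ∀ s, γ s ∈ V) (hγ' : γ' ∈ V)
    (h : HasDerivAt (fun s => A (γ s)) (A γ') s₀) : M.HasSKDerivAt γ γ' s₀ :=
  hasSKDerivAt_of_injOn A V hA hγ hγ' (hasDerivAt_iff_tendsto_slope.mp h)

/-- **Orbit maps of vectors in a finite-dimensional invariant subspace** (the `K`-finite situation): if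
`ω(e s)Φ ∈ V` for all `s`, `X ∈ V`, and after an observation `A` injective on `V` (an `L²`-realisation, say) the
orbit has derivative `A X` at `s₀`, then `s ↦ ω(e s)Φ` has `SK`-derivative `X` at `s₀` in Weil's topology. -/
theorem hasSKDerivAt_orbit_of_injOn {E : Type*} [NormedAddCommGroup E] [NormedSpace ℂ E]
    (A : M.SK →ₗ[ℂ] E) (V : Submodule ℂ M.SK) [FiniteDimensional ℂ V] (hA : ∀ v ∈ V, A v = 0 → v = 0)
    (e : ℝ → G) (Φ X : M.SK) {s₀ : ℝ} (hV : ∀ s, M.omg (e s) Φ ∈ V) (hX : X ∈ V)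
    (h : HasDerivAt (fun s => A (M.omg (e s) Φ)) (A X) s₀) :
    M.HasSKDerivAt (fun s => M.omg (e s) Φ) X s₀ :=
  hasSKDerivAt_of_injOn_of_hasDerivAt A V hA hV hX h

/-- **Detection on the span of finitely many vectors with linearly independent images.**  If `A Φ₁, …, A Φₙ` are
linearly independent in `E`, a curve in `span {Φ₁, …, Φₙ}` with candidate derivative in that span is
`SK`-differentiable as soon as `A ∘ γ` is differentiable with derivative `A γ'`. -/
theorem hasSKDerivAt_of_linearIndependent {E : Type*} [AddCommGroup E] [Module ℂ E] [TopologicalSpace E]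
    [IsTopologicalAddGroup E] [ContinuousSMul ℂ E] [T2Space E] {n : Type*} [Fintype n]
    (A : M.SK →ₗ[ℂ] E) (Φ : n → M.SK) (hA : LinearIndependent ℂ fun i => A (Φ i))
    {γ : ℝ → M.SK} {γ' : M.SK} {s₀ : ℝ} (hγ : ∀ s, γ s ∈ Submodule.span ℂ (Set.range Φ))
    (hγ' : γ' ∈ Submodule.span ℂ (Set.range Φ))
    (h : Tendsto (slope (fun s => A (γ s)) s₀) (𝓝[≠] s₀) (𝓝 (A γ'))) : M.HasSKDerivAt γ γ' s₀ := by
  haveI : FiniteDimensional ℂ (Submodule.span ℂ (Set.range Φ)) :=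
    FiniteDimensional.span_of_finite ℂ (Set.finite_range Φ)
  refine hasSKDerivAt_of_injOn A (Submodule.span ℂ (Set.range Φ)) (fun v hv hv0 => ?_) hγ hγ' h
  obtain ⟨c, rfl⟩ := (Submodule.mem_span_range_iff_exists_fun ℂ).mp hv
  have hc : ∀ i, c i = 0 := by
    refine Fintype.linearIndependent_iff.mp hA c ?_
    simpa [map_sum, map_smul] using hv0
  simp [hc]

end FiniteDimensional

end WeilThetaModel

/-! ## §6  The constructed models -/

namespace SchwartzWeil

open WeilThetaModel

section Schrodinger

variable (E : Type) [NormedAddCommGroup E] [NormedSpace ℝ E] [FiniteDimensional ℝ E]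
  (L : Submodule ℤ E) [DiscreteTopology L] (m : ℤ) (Γ : Subgroup Circle) (hΓ : ∀ u ∈ Γ, u ^ m = 1)

/-- (Ported verbatim from the HodgeCMPerL package; no docstring in the source.) -/
instance continuousAdd_schrodingerModel : ContinuousAdd (schrodingerModel E L m Γ hΓ).W.SX :=
  inferInstanceAs (ContinuousAdd 𝓢(E, ℂ))
/-- (Ported verbatim from the HodgeCMPerL package; no docstring in the source.) -/
instance continuousSMul_schrodingerModel : ContinuousSMul ℂ (schrodingerModel E L m Γ hΓ).W.SX :=
  inferInstanceAs (ContinuousSMul ℂ 𝓢(E, ℂ))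
/-- (Ported verbatim from the HodgeCMPerL package; no docstring in the source.) -/
instance t2Space_schrodingerModel : T2Space (schrodingerModel E L m Γ hΓ).W.SX :=
  inferInstanceAs (T2Space 𝓢(E, ℂ))

/-- (Ported verbatim from the HodgeCMPerL package; no docstring in the source.) -/
instance continuousAdd_schrodingerModelBot : ContinuousAdd (schrodingerModelBot E L m).W.SX :=
  inferInstanceAs (ContinuousAdd 𝓢(E, ℂ))
/-- (Ported verbatim from the HodgeCMPerL package; no docstring in the source.) -/
instance continuousSMul_schrodingerModelBot : ContinuousSMul ℂ (schrodingerModelBot E L m).W.SX :=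
  inferInstanceAs (ContinuousSMul ℂ 𝓢(E, ℂ))
/-- (Ported verbatim from the HodgeCMPerL package; no docstring in the source.) -/
instance t2Space_schrodingerModelBot : T2Space (schrodingerModelBot E L m).W.SX :=
  inferInstanceAs (T2Space 𝓢(E, ℂ))

end Schrodinger

section Heisenberg

variable (V : Type) [NormedAddCommGroup V] [InnerProductSpace ℝ V] [FiniteDimensional ℝ V] [MeasurableSpace V]
  [BorelSpace V] (L : Submodule ℤ V) (m : ℤ) [DiscreteTopology L] (Γ : Subgroup Circle)
  (hΓ : ∀ u ∈ Γ, u ^ m = 1)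

/-- (Ported verbatim from the HodgeCMPerL package; no docstring in the source.) -/
instance continuousAdd_heisenbergModel : ContinuousAdd (heisenbergModel V L m Γ hΓ).W.SX :=
  inferInstanceAs (ContinuousAdd 𝓢(V, ℂ))
/-- (Ported verbatim from the HodgeCMPerL package; no docstring in the source.) -/
instance continuousSMul_heisenbergModel : ContinuousSMul ℂ (heisenbergModel V L m Γ hΓ).W.SX :=
  inferInstanceAs (ContinuousSMul ℂ 𝓢(V, ℂ))
/-- (Ported verbatim from the HodgeCMPerL package; no docstring in the source.) -/
instance t2Space_heisenbergModel : T2Space (heisenbergModel V L m Γ hΓ).W.SX :=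
  inferInstanceAs (T2Space 𝓢(V, ℂ))

variable [IsZLattice ℝ L] [NeZero m] [Finite Γ]

/-- (Ported verbatim from the HodgeCMPerL package; no docstring in the source.) -/
instance continuousAdd_heisenbergModelOverLattice : ContinuousAdd (heisenbergModelOverLattice V L m Γ hΓ).W.SX :=
  inferInstanceAs (ContinuousAdd 𝓢(V, ℂ))
/-- (Ported verbatim from the HodgeCMPerL package; no docstring in the source.) -/
instance continuousSMul_heisenbergModelOverLattice :
    ContinuousSMul ℂ (heisenbergModelOverLattice V L m Γ hΓ).W.SX :=
  inferInstanceAs (ContinuousSMul ℂ 𝓢(V, ℂ))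
/-- (Ported verbatim from the HodgeCMPerL package; no docstring in the source.) -/
instance t2Space_heisenbergModelOverLattice : T2Space (heisenbergModelOverLattice V L m Γ hΓ).W.SX :=
  inferInstanceAs (T2Space 𝓢(V, ℂ))

end Heisenberg

section Std

/-- (Ported verbatim from the HodgeCMPerL package; no docstring in the source.) -/
instance continuousAdd_heisenbergModelStd (n : ℕ) (m : ℤ) [NeZero m] :
    ContinuousAdd (heisenbergModelStd n m).W.SX :=
  inferInstanceAs (ContinuousAdd 𝓢(EuclideanSpace ℝ (Fin n), ℂ))
/-- (Ported verbatim from the HodgeCMPerL package; no docstring in the source.) -/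
instance continuousSMul_heisenbergModelStd (n : ℕ) (m : ℤ) [NeZero m] :
    ContinuousSMul ℂ (heisenbergModelStd n m).W.SX :=
  inferInstanceAs (ContinuousSMul ℂ 𝓢(EuclideanSpace ℝ (Fin n), ℂ))
/-- (Ported verbatim from the HodgeCMPerL package; no docstring in the source.) -/
instance t2Space_heisenbergModelStd (n : ℕ) (m : ℤ) [NeZero m] : T2Space (heisenbergModelStd n m).W.SX :=
  inferInstanceAs (T2Space 𝓢(EuclideanSpace ℝ (Fin n), ℂ))

end Std

namespace HeisenbergKernel

variable (V : Type) [NormedAddCommGroup V] [InnerProductSpace ℝ V] [FiniteDimensional ℝ V] [MeasurableSpace V]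
  [BorelSpace V] (L : Submodule ℤ V) [DiscreteTopology L] (m : ℤ) (Γz : Subgroup Circle)
  (hΓz : ∀ z ∈ Γz, z ^ m = 1)

/-- (Ported verbatim from the HodgeCMPerL package; no docstring in the source.) -/
instance continuousAdd_centerModel : ContinuousAdd (centerModel V L m Γz hΓz).W.SX :=
  inferInstanceAs (ContinuousAdd 𝓢(V, ℂ))
/-- (Ported verbatim from the HodgeCMPerL package; no docstring in the source.) -/
instance continuousSMul_centerModel : ContinuousSMul ℂ (centerModel V L m Γz hΓz).W.SX :=
  inferInstanceAs (ContinuousSMul ℂ 𝓢(V, ℂ))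
/-- (Ported verbatim from the HodgeCMPerL package; no docstring in the source.) -/
instance t2Space_centerModel : T2Space (centerModel V L m Γz hΓz).W.SX :=
  inferInstanceAs (T2Space 𝓢(V, ℂ))

/-- **`ω` is multiplicative in the centre–Heisenberg kernel model**: `ω(h h')Φ = ω(h)(ω(h')Φ)` (`ρ_m` is a
representation, pv14-g5 `repCLM_mul`). -/
theorem centerModel_omg_mul (h h' : Heis V) (Φ : (centerModel V L m Γz hΓz).SK) :
    (centerModel V L m Γz hΓz).omg (h * h') Φ =
      (centerModel V L m Γz hΓz).omg h ((centerModel V L m Γz hΓz).omg h' Φ) := by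
  apply Subtype.ext
  rw [centerModel_omg, centerModel_omg, centerModel_omg, repCLM_mul_apply]

/-- The derivative vector of pv02-g7's `hasSKDerivAt_centerModel_expCurve` is pv14-g6's generator
`dρ_m(a, b, c)Φ = schrodingerGen V m a b c Φ`. -/
theorem hasSKDerivAt_centerModel_expCurve' (a b : V) (c : ℝ) (Φ : 𝓢(V, ℂ)) :
    (centerModel V L m Γz hΓz).HasSKDerivAt
      (fun s => (centerModel V L m Γz hΓz).omg (Heis.expCurve a b c s) ⟨Φ, Set.mem_univ Φ⟩)
      ⟨schrodingerGen V m a b c Φ, Set.mem_univ _⟩ 0 :=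
  hasSKDerivAt_centerModel_expCurve V L m Γz hΓz a b c Φ

/-- **Differentiability at every parameter**: `s ↦ ω(γ_{a,b,c}(s))Φ` has `SK`-derivative
`ω(γ_{a,b,c}(s₀)) (dρ_m(a,b,c) Φ)` at `s₀` (one-parameter subgroup law + `ω` multiplicative + pv02-g7's
`hasSKDerivAt_orbit_of_zero`). -/
theorem hasSKDerivAt_centerModel_expCurve_at (a b : V) (c : ℝ) (Φ : 𝓢(V, ℂ)) (s₀ : ℝ) :
    (centerModel V L m Γz hΓz).HasSKDerivAt
      (fun s => (centerModel V L m Γz hΓz).omg (Heis.expCurve a b c s) ⟨Φ, Set.mem_univ Φ⟩)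
      ((centerModel V L m Γz hΓz).omg (Heis.expCurve a b c s₀) ⟨schrodingerGen V m a b c Φ, Set.mem_univ _⟩)
      s₀ :=
  hasSKDerivAt_orbit_of_zero (Heis.expCurve a b c) _ _ s₀
    (fun s => by rw [Heis.expCurve_add, centerModel_omg_mul])
    (hasSKDerivAt_centerModel_expCurve' V L m Γz hΓz a b c Φ)

/-- **The Leibniz rule at work on a non-commutative group: products of two one-parameter subgroups of `Heis V`.**
`s ↦ ω(γ₁(s) γ₂(s))Φ` — NOT the orbit of a one-parameter subgroup when `[X₁, X₂] ≠ 0`, i.e. when the symplectic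
pairing of `(a₁, b₁)` and `(a₂, b₂)` is non-zero — has `SK`-derivative `dρ_m(X₁)Φ + dρ_m(X₂)Φ` at `s = 0`, in the
Schwartz topology. -/
theorem hasSKDerivAt_centerModel_expCurve_mul (a₁ b₁ : V) (c₁ : ℝ) (a₂ b₂ : V) (c₂ : ℝ) (Φ : 𝓢(V, ℂ)) :
    (centerModel V L m Γz hΓz).HasSKDerivAt
      (fun s => (centerModel V L m Γz hΓz).omg (Heis.expCurve a₁ b₁ c₁ s * Heis.expCurve a₂ b₂ c₂ s)
        ⟨Φ, Set.mem_univ Φ⟩)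
      (⟨schrodingerGen V m a₁ b₁ c₁ Φ, Set.mem_univ _⟩ + ⟨schrodingerGen V m a₂ b₂ c₂ Φ, Set.mem_univ _⟩) 0 :=
  hasSKDerivAt_omg_mul_of_eq_one (Heis.continuous_expCurve a₁ b₁ c₁).continuousAt (Heis.expCurve_zero a₁ b₁ c₁)
    (Heis.expCurve_zero a₂ b₂ c₂) _ (fun _ => centerModel_omg_mul V L m Γz hΓz _ _ _)
    (hasSKDerivAt_centerModel_expCurve' V L m Γz hΓz a₁ b₁ c₁ Φ)
    (hasSKDerivAt_centerModel_expCurve' V L m Γz hΓz a₂ b₂ c₂ Φ)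

/-- The same fact read in `𝓢(V, ℂ)`: `s⁻¹ • (ρ_m(γ₁(s)γ₂(s))Φ − Φ) ⟶ dρ_m(X₁)Φ + dρ_m(X₂)Φ` in the Schwartz topology. -/
theorem tendsto_repCLM_expCurve_mul_sub_smul (a₁ b₁ : V) (c₁ : ℝ) (a₂ b₂ : V) (c₂ : ℝ) (Φ : 𝓢(V, ℂ)) :
    Tendsto (fun s : ℝ => s⁻¹ • (repCLM V m (Heis.expCurve a₁ b₁ c₁ s * Heis.expCurve a₂ b₂ c₂ s) Φ - Φ))
      (𝓝[≠] 0) (𝓝 (schrodingerGen V m a₁ b₁ c₁ Φ + schrodingerGen V m a₂ b₂ c₂ Φ)) := by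
  -- any admissible pair `(L, Γz)` will do: the statement does not mention the lattice data
  have h := WeilThetaModel.hasSKDerivAt_iff_val.mp
    (hasSKDerivAt_centerModel_expCurve_mul V (⊥ : Submodule ℤ V) m ⊥
      (fun z hz => by rw [Subgroup.mem_bot.mp hz, one_zpow]) a₁ b₁ c₁ a₂ b₂ c₂ Φ)
  refine Filter.Tendsto.congr (fun s => ?_) h
  rw [slope_def_module, sub_zero, centerModel_omg, centerModel_omg, Heis.expCurve_zero, Heis.expCurve_zero, mul_one,
    repCLM_one_apply]
  rfl

end HeisenbergKernel

end SchwartzWeil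

end HodgeCM

-- port_pkg: scope closed for this part
end
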